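import Literature.AlgebraicGeometry.AbelianSchemes.MFKSubfunctorOfHilbIntrinsic
import Literature.AlgebraicGeometry.AbelianSchemes.MumfordBundleIsoTransport
import Literature.AlgebraicGeometry.AbelianSchemes.MFKClausesIsoTransport
import Literature.AlgebraicGeometry.AbelianSchemes.LevelStructureTransportIso
import Literature.AlgebraicGeometry.AbelianSchemes.HomKernelTorsionCount
import Literature.AlgebraicGeometry.AbelianVarieties.LineBundleTensorPower
import HarnessLib

/-!
# The MFK sub-functor of Hilb, INTRINSIC form — the converse and the `T`-point description
# ([MumfordFogartyKirwan1994] Prop. 7.3, steps (I)–(VI); sequel of ★ `MFKSubfunctorOfHilbIntrinsic`)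

Topic `AlgebraicGeometry/AbelianSchemes`; namespace `Literature.AlgebraicGeometry.AbelianSchemes.AbelianSchemeOver`; universe `0`.
Cell hodgecm-mathlib (D-0151), F-DAG leaf F-6, capstone (H-int) part 2 (B-p02 (g14); consumer (H-rep), B-p18 (g19)).  THEOREMS
ONLY; books 0.  HC_CM is proved only modulo the 7 printed citations until rung 0 closes; this file discharges none of them.

* **`existsUnique_comp_of_mfkIntrinsic`** — `INT(b)` ⟹ `b` factors uniquely through `j ≫ j₂ ≫ j₁`: storeys (I), (II) (the group
  law of `A_b` moved to `Z₁ ×_{H₁} T`, Mathlib `GrpObj.ofIso`) give `v : T → H₂`; the comparison `e : A_b ≅ A₂ ×_{H₂} T` preserves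
  the units, so is a homomorphism ([MumfordFogartyKirwan1994] Cor. 6.4, ★ `isMonHom_of_one_comp_of_isLocallyNoetherian_base`), and
  with the dual transport `Ĥ_e` (★ `hatTransport`) every clause of Prop. 7.3 (V)/(P)/(III)(IV)(V′)/(VI) moves from `(A_b, D_b)` to
  `(A₂ ×_{H₂} T, D₂ ×_{H₂} T)` (★ `MumfordBundleIsoTransport` (B-p17), ★ `MFKClausesIsoTransport`, ★ `Polarization.hasType_of_isBaseChangeVia`, ★
  `LevelStructure.exists_comp_of_iso`, ★ `LevelStructure.isSymplecticLiftable_of_isBaseChangeVia`); `[6] ≫ λ = Λ(L′)_T` is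
  recovered from the classification letter by the uniqueness of `Λ` (★ `eq_of_classify_mumfordBundle`);
* HEAD **`existsUnique_comp_iff_mfkIntrinsic`** — `(∃! w, w ≫ j ≫ j₂ ≫ j₁ = b) ↔ INT(b)` (with ★ `mfkIntrinsic_of_existsUnique_comp`).

## References
* [MumfordFogartyKirwan1994] D. Mumford, J. Fogarty, F. Kirwan, *Geometric Invariant Theory*, 3rd ed. (1994), Ch. 6 §1
  Corollary 6.4 (p. 117), Ch. 6 §2 Definition 6.2 (p. 120), Prop. 6.10 (p. 121), Prop. 6.11 (p. 122), Ch. 7 §2 Definition 7.2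
  (p. 129), Proposition 7.3 and its proof (pp. 132–134).
-/

set_option backward.isDefEq.respectTransparency false

noncomputable section

open CategoryTheory CategoryTheory.Limits AlgebraicGeometry MonoidalCategory Cardinal MonObj

namespace Literature.AlgebraicGeometry.AbelianSchemes

namespace AbelianSchemeOver

open Literature.AlgebraicGeometry.Motives Literature.AlgebraicGeometry.ModuliOfAbelianVarieties
  Literature.AlgebraicGeometry.Modules Literature.AlgebraicGeometry.AbelianVarieties Literature.AlgebraicGeometry.Morphisms
open scoped MonObj

/-- Congruence of the (VI)-clause in the top and bottom arrows of the square. [folklore] -/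
private theorem isIso_comp_pushforwardBaseChangeHom_congr {X S T XT : Scheme.{0}} {p : X ⟶ S} {b b' : T ⟶ S}
    {pr pr' : XT ⟶ X} {pT : XT ⟶ T} (hb : b = b') (hpr : pr = pr') {w : pr ≫ p = pT ≫ b} {w' : pr' ≫ p = pT ≫ b'}
    (G : X.Modules) {E : S.Modules} (u : E ⟶ (Scheme.Modules.pushforward p).obj G) :
    IsIso ((Scheme.Modules.pullback b).map u ≫ pushforwardBaseChangeHom w G) ↔
      IsIso ((Scheme.Modules.pullback b').map u ≫ pushforwardBaseChangeHom w' G) := by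
  subst hb; subst hpr; exact Iff.rfl

/-- Tensor powers of isomorphic modules are isomorphic. [folklore] -/
private theorem nonempty_tensorPow_iso_of_iso' {X : Scheme.{0}} {M M' : X.Modules} (e : M ≅ M') :
    ∀ n : ℕ, Nonempty (tensorPow M n ≅ tensorPow M' n)
  | 0 => ⟨Iso.refl _⟩
  | n + 1 => (nonempty_tensorPow_iso_of_iso' e n).map fun i => tensorMapIso i e


/-! ### From the INTRINSIC clause to the factorisation through the tower, and the HEAD -/

section Converse

variable {H₀ Z₀ : Scheme.{0}} (p₀ : Z₀ ⟶ H₀) (ε₀ : H₀ ⟶ Z₀) {g N : ℕ} (τ₀ : Fin g ⊕ Fin g → (H₀ ⟶ Z₀))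
  (L₀ : Z₀.Modules) (δ : Fin g → ℕ)
  (u₀ : freeModule H₀ (Fin (6 ^ g * polarizationDegree δ)) ⟶ (Scheme.Modules.pushforward p₀).obj L₀)
  {H₁ H₂ H : Scheme.{0}} (j₁ : H₁ ⟶ H₀) (j₂ : H₂ ⟶ H₁) (j : H ⟶ H₂)
  (A₂ : AbelianSchemeOver H₂) (pr₂ : A₂.X.left ⟶ Z₀) (sq₂ : IsPullback pr₂ A₂.X.hom p₀ (j₂ ≫ j₁))
  (hg₂ : A₂.IsOfRelDim g) (hunit₂ : A₂.unitSection ≫ pr₂ = (j₂ ≫ j₁) ≫ ε₀)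
  (σ₂ : Fin g ⊕ Fin g → A₂.Sections) (hσ₂ : ∀ i, (σ₂ i).left ≫ pr₂ = (j₂ ≫ j₁) ≫ τ₀ i)
  (D₂ : A₂.DualPair)
  (hD₂ : Nonempty ((Scheme.Modules.pullback (DualPair.unitHatSlice D₂)).obj D₂.P ≅ SheafOfModules.unit _))
  (hL₀ : HasRank L₀ 1)
  (eF : (Scheme.Modules.pullback (j₂ ≫ j₁)).obj (freeModule H₀ (Fin (6 ^ g * polarizationDegree δ))) ≅
    freeModule H₂ (Fin (6 ^ g * polarizationDegree δ)))
  (lam : A₂.X ⟶ D₂.hat.X)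
  (hlam : ∀ ⦃U : Over H₂⦄ (a : U ⟶ A₂.X),
    Nonempty ((Scheme.Modules.pullback (A₂.X ◁ (a ≫ lam)).left).obj D₂.P ≅
      (Scheme.Modules.pullback (A₂.X ◁ a).left).obj (A₂.mumfordBundle
        (tensorObj ((Scheme.Modules.pullback pr₂).obj L₀) ((Scheme.Modules.pullback A₂.X.hom).obj
          (Modules.dual ((Scheme.Modules.pullback A₂.unitSection).obj
            ((Scheme.Modules.pullback pr₂).obj L₀))))))))

include sq₂ hunit₂ hσ₂ hD₂ hL₀ hlam in
/-- **FROM THE INTRINSIC CLAUSE TO THE TOWER.**  In the setting exported by ★ FILE 2 `exists_isImmersion_iff_mfkSubfunctor`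
(universal properties `h₁` of the (I)-locus, `h₂` of the (II)-locus, `h` of ★ FILE 1's immersion `j : H ⟶ H₂` over the abelian scheme
`A₂ → H₂` with its square `sq₂`, unit, sections, rigidified dual pair and `Λ(L′)`), every `b : T ⟶ H₀` from a locally Noetherian `T`
with `INT(b)` factors uniquely through `j ≫ j₂ ≫ j₁`.  Storey (I) is the fibre clause; storey (II) is the group law of `A_b` moved to
`Z₁ ×_{H₁} T` (`GrpObj.ofIso`); over the resulting `v`, the comparison `e : A_b ≅ A₂ ×_{H₂} T` preserves the units, hence is a
homomorphism ([MumfordFogartyKirwan1994] Cor. 6.4), and with `Ĥ_e` (★ `hatTransport`, Poincaré clause, ★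
`hat_isBaseChangeVia_id_hatTransport_of_isLocallyNoetherian_base`) the polarisation (★ `Polarization.exists_lam_eq_lamTransport`), its
type, the level structure and its liftability, the module clause (V), the frame clause (VI) and — by the uniqueness of `Λ` (★
`eq_of_classify_mumfordBundle`, ★ `forall_nonempty_classify_lamTransport`) — the equation `[6] ≫ λ = Λ(L′)_T` all move across.
[cite: MumfordFogartyKirwan1994, Ch. 7 §2 Proposition 7.3 (pp. 132–134)] [cite: MumfordFogartyKirwan1994, Ch. 7 §2 Definition 7.2 (p. 129)]
[cite: MumfordFogartyKirwan1994, Ch. 6 §1 Corollary 6.2 and Corollary 6.4 (p. 117)] -/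
theorem existsUnique_comp_of_mfkIntrinsic [Mono j₁] [Mono j₂] [Mono j]
    (h₁ : ∀ {T XT : Scheme.{0}} (b : T ⟶ H₀) {pr : XT ⟶ Z₀} {pT : XT ⟶ T} (_ : IsPullback pr pT p₀ b),
      (∃! v₁ : T ⟶ H₁, v₁ ≫ j₁ = b) ↔ Smooth pT ∧ GeometricallyConnected pT)
    (h₂ : ∀ ⦃T : Scheme.{0}⦄ (v₁ : T ⟶ H₁),
      (∃! v : T ⟶ H₂, v ≫ j₂ = v₁) ↔
        ∃ G' : GrpObj (Over.mk (pullback.snd (pullback.snd p₀ j₁) v₁)),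
          (@MonObj.one _ _ _ (Over.mk (pullback.snd (pullback.snd p₀ j₁) v₁)) G'.toMonObj).left ≫
              pullback.fst (pullback.snd p₀ j₁) v₁ ≫ pullback.fst p₀ j₁ = (v₁ ≫ j₁) ≫ ε₀ ∧
          SmoothOfRelativeDimension g (pullback.snd (pullback.snd p₀ j₁) v₁))
    (h : ∀ ⦃T : Scheme.{0}⦄ [IsLocallyNoetherian T] (v : T ⟶ H₂),
      (∃! w : T ⟶ H, w ≫ j = v) ↔
        ∃ (ω : (A₂.baseChange v).X ⟶ (D₂.hat.baseChange v).X)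
          (Γ₁ : (A₂.baseChange v).left ⟶ A₂.prodLeft D₂.hat),
          IsMonHom ω ∧ ((𝟙 (A₂.baseChange v).X) ^ 6) ≫ ω = (Over.pullback v).map lam ∧
            Γ₁ ≫ pullback.fst A₂.X.hom D₂.hat.X.hom = pullback.fst A₂.X.hom v ∧
            Γ₁ ≫ pullback.snd A₂.X.hom D₂.hat.X.hom = ω.left ≫ pullback.fst D₂.hat.X.hom v ∧
            Nonempty ((Scheme.Modules.pullback (pullback.fst A₂.X.hom v)).obj
                (tensorObj ((Scheme.Modules.pullback pr₂).obj L₀) ((Scheme.Modules.pullback A₂.X.hom).obj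
                  (Modules.dual ((Scheme.Modules.pullback A₂.unitSection).obj
                    ((Scheme.Modules.pullback pr₂).obj L₀))))) ≅
              tensorPow ((Scheme.Modules.pullback Γ₁).obj D₂.P) 3) ∧
            ∃ pol : (A₂.baseChange v).Polarization (D₂.baseChange v), pol.lam = ω ∧ pol.HasType δ ∧
              (∃ φ : LevelStructure g N (A₂.baseChange v),
                (∀ i, φ.σ i = A₂.sectionBaseChange v (σ₂ i)) ∧ φ.IsSymplecticLiftable pol δ) ∧
              IsIso ((Scheme.Modules.pullback v).map
                  (eF.inv ≫ (Scheme.Modules.pullback (j₂ ≫ j₁)).map u₀ ≫ pushforwardBaseChangeHom sq₂.w L₀) ≫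
                pushforwardBaseChangeHom (IsPullback.of_hasPullback A₂.X.hom v).w
                  ((Scheme.Modules.pullback pr₂).obj L₀)))
    {T : Scheme.{0}} [IsLocallyNoetherian T] (b : T ⟶ H₀)
    (hINT : Smooth (pullback.snd p₀ b) ∧ GeometricallyConnected (pullback.snd p₀ b) ∧
      ∃ (Ab : AbelianSchemeOver T) (prb : Ab.X.left ⟶ Z₀) (sqb : IsPullback prb Ab.X.hom p₀ b)
        (_ : Ab.IsOfRelDim g) (_ : Ab.unitSection ≫ prb = b ≫ ε₀)
        (σb : Fin g ⊕ Fin g → Ab.Sections) (_ : ∀ i, (σb i).left ≫ prb = b ≫ τ₀ i)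
        (Db : Ab.DualPair)
        (_ : Nonempty ((Scheme.Modules.pullback (DualPair.unitHatSlice Db)).obj Db.P ≅ SheafOfModules.unit _))
        (Lb : Ab.left.Modules) (_ : Nonempty (Lb ≅ (Scheme.Modules.pullback prb).obj L₀))
        (ω : Ab.X ⟶ Db.hat.X) (Γ₁ : Ab.left ⟶ Ab.prodLeft Db.hat),
        IsMonHom ω ∧
          (∀ ⦃U : Over T⦄ (a : U ⟶ Ab.X),
            Nonempty ((Scheme.Modules.pullback (Ab.X ◁ (a ≫ ((𝟙 Ab.X) ^ 6) ≫ ω)).left).obj Db.P ≅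
              (Scheme.Modules.pullback (Ab.X ◁ a).left).obj (Ab.mumfordBundle
                (tensorObj Lb ((Scheme.Modules.pullback Ab.X.hom).obj
                  (Modules.dual ((Scheme.Modules.pullback Ab.unitSection).obj Lb))))))) ∧
          Γ₁ ≫ pullback.fst Ab.X.hom Db.hat.X.hom = 𝟙 _ ∧
          Γ₁ ≫ pullback.snd Ab.X.hom Db.hat.X.hom = ω.left ∧
          Nonempty (tensorObj Lb ((Scheme.Modules.pullback Ab.X.hom).obj
              (Modules.dual ((Scheme.Modules.pullback Ab.unitSection).obj Lb))) ≅
            tensorPow ((Scheme.Modules.pullback Γ₁).obj Db.P) 3) ∧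
          ∃ pol : Ab.Polarization Db, pol.lam = ω ∧ pol.HasType δ ∧
            (∃ φ : LevelStructure g N Ab, (∀ i, φ.σ i = σb i) ∧ φ.IsSymplecticLiftable pol δ) ∧
            IsIso ((Scheme.Modules.pullback b).map u₀ ≫ pushforwardBaseChangeHom sqb.w L₀)) :
    ∃! w : T ⟶ H, w ≫ j ≫ j₂ ≫ j₁ = b := by
  obtain ⟨hsm, hgc, Ab, prb, sqb, hgb, hunitb, σb, hσb, Db, hDb, Lb, ⟨eLb⟩, ωA, Γ₁A, hωAm, hletA, hΓA₁, hΓA₂, ⟨eA3⟩,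
    polA, hpolA, hTA, ⟨φA, hφA, hLA⟩, hVIA⟩ := hINT
  subst hpolA
  rw [existsUnique_comp_iff_of_storeys j₁ j₂ j (fun b' => h₁ b' (IsPullback.of_hasPullback p₀ b')) (fun v₁ => h₂ v₁)
    (fun v => h v) b]
  refine ⟨⟨hsm, hgc⟩, ?_⟩
  obtain ⟨v₁, hv₁, -⟩ := (h₁ b (IsPullback.of_hasPullback p₀ b)).2 ⟨hsm, hgc⟩
  subst hv₁
  have sq1 : IsPullback (pullback.fst (pullback.snd p₀ j₁) v₁ ≫ pullback.fst p₀ j₁)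
      (pullback.snd (pullback.snd p₀ j₁) v₁) p₀ (v₁ ≫ j₁) :=
    (IsPullback.of_hasPullback _ _).paste_horiz (IsPullback.of_hasPullback p₀ j₁)
  have hE₁fst : (sqb.isoIsPullback _ _ sq1).hom ≫ pullback.fst (pullback.snd p₀ j₁) v₁ ≫ pullback.fst p₀ j₁ = prb :=
    sqb.isoIsPullback_hom_fst _ _ sq1
  have hE₁snd : (sqb.isoIsPullback _ _ sq1).hom ≫ pullback.snd (pullback.snd p₀ j₁) v₁ = Ab.X.hom :=
    sqb.isoIsPullback_hom_snd _ _ sq1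
  let eO₁ : Ab.X ≅ Over.mk (pullback.snd (pullback.snd p₀ j₁) v₁) := Over.isoMk (sqb.isoIsPullback _ _ sq1) hE₁snd
  have hP₂ : ∃ G' : GrpObj (Over.mk (pullback.snd (pullback.snd p₀ j₁) v₁)),
      (@MonObj.one _ _ _ (Over.mk (pullback.snd (pullback.snd p₀ j₁) v₁)) G'.toMonObj).left ≫
          pullback.fst (pullback.snd p₀ j₁) v₁ ≫ pullback.fst p₀ j₁ = (v₁ ≫ j₁) ≫ ε₀ ∧
      SmoothOfRelativeDimension g (pullback.snd (pullback.snd p₀ j₁) v₁) := by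
    refine ⟨GrpObj.ofIso eO₁, ?_, ?_⟩
    · change (Ab.unitSection ≫ (sqb.isoIsPullback _ _ sq1).hom) ≫
          pullback.fst (pullback.snd p₀ j₁) v₁ ≫ pullback.fst p₀ j₁ = (v₁ ≫ j₁) ≫ ε₀
      exact (Category.assoc _ _ _).trans ((whisker_eq Ab.unitSection hE₁fst).trans hunitb)
    · have hsnd : pullback.snd (pullback.snd p₀ j₁) v₁ = (sqb.isoIsPullback _ _ sq1).inv ≫ Ab.X.hom :=
        ((sqb.isoIsPullback _ _ sq1).eq_inv_comp).2 hE₁snd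
      rw [hsnd]
      exact (MorphismProperty.cancel_left_of_respectsIso (@SmoothOfRelativeDimension g) _ _).mpr
        ((Ab.isOfRelDim_iff g).1 hgb)
  obtain ⟨v, hv, -⟩ := (h₂ v₁).2 hP₂
  subst hv
  refine ⟨v ≫ j₂, rfl, hP₂, v, rfl, ?_⟩
  have sqv : IsPullback (pullback.fst A₂.X.hom v) (pullback.snd A₂.X.hom v) A₂.X.hom v := IsPullback.of_hasPullback _ _
  have sqB : IsPullback (pullback.fst A₂.X.hom v ≫ pr₂) (pullback.snd A₂.X.hom v) p₀ ((v ≫ j₂) ≫ j₁) := by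
    rw [Category.assoc]; exact sqv.paste_horiz sq₂
  have hEfst : (sqb.isoIsPullback _ _ sqB).hom ≫ pullback.fst A₂.X.hom v ≫ pr₂ = prb := sqb.isoIsPullback_hom_fst _ _ sqB
  have hEsnd : (sqb.isoIsPullback _ _ sqB).hom ≫ pullback.snd A₂.X.hom v = Ab.X.hom := sqb.isoIsPullback_hom_snd _ _ sqB
  have hEinv : (sqb.isoIsPullback _ _ sqB).inv ≫ prb = pullback.fst A₂.X.hom v ≫ pr₂ := sqb.isoIsPullback_inv_fst _ _ sqB
  let eO : Ab.X ≅ (A₂.baseChange v).X := Over.isoMk (sqb.isoIsPullback _ _ sqB) hEsnd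
  have heOl : eO.hom.left = (sqb.isoIsPullback _ _ sqB).hom := rfl
  have heOil : eO.inv.left = (sqb.isoIsPullback _ _ sqB).inv := rfl
  have hl : (A₂.baseChange v).unitSection ≫ pullback.fst A₂.X.hom v ≫ pr₂ = v ≫ A₂.unitSection ≫ pr₂ :=
    A₂.unitSection_baseChange_comp_fst_assoc v pr₂
  have hunitE : Ab.unitSection ≫ eO.hom.left = (A₂.baseChange v).unitSection := by
    apply sqB.hom_ext
    · rw [Category.assoc, heOl, hEfst, hunitb]
      exact (hl.trans (by rw [hunit₂]; simp only [Category.assoc])).symm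
    · rw [Category.assoc, heOl, hEsnd, Ab.unitSection_comp_hom]
      exact ((A₂.baseChange v).unitSection_comp_hom).symm
  have heO : η[Ab.X] ≫ eO.hom = η[(A₂.baseChange v).X] := Over.OverMorphism.ext (by
    rw [Over.comp_left]; exact hunitE)
  haveI hmon : IsMonHom eO.hom := isMonHom_of_one_comp_of_isLocallyNoetherian_base eO.hom heO
  have heO' : η[(A₂.baseChange v).X] ≫ eO.inv = η[Ab.X] := by
    rw [← heO, Category.assoc, eO.hom_inv_id, Category.comp_id]
  haveI hmon' : IsMonHom eO.inv := isMonHom_of_one_comp_of_isLocallyNoetherian_base eO.inv heO'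
  haveI : IsMonHom eO.symm.hom := hmon'
  have hAB : Ab.IsBaseChangeVia (A₂.baseChange v) (𝟙 T) eO.hom.left := isBaseChangeVia_id_of_isMonHom _ _ eO.hom
  have hDB := D₂.nonempty_unitHatSlice_baseChange_iso (g := v) hD₂
  have hABh : Db.hat.IsBaseChangeVia (D₂.baseChange v).hat (𝟙 T) (DualPair.hatTransport (D₂.baseChange v) Db eO) :=
    DualPair.hat_isBaseChangeVia_id_hatTransport_of_isLocallyNoetherian_base _ _ eO eO.symm rfl hDB hDb
  obtain ⟨eP⟩ := DualPair.nonempty_pullback_map_hatTransport_iso (D₂.baseChange v) Db eO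
  obtain ⟨pol, hpol⟩ := Polarization.exists_lam_eq_lamTransport Db (D₂.baseChange v) eO.symm eO rfl hDb hDB polA
  have hpoll : pol.lam.left = eO.inv.left ≫ polA.lam.left ≫ DualPair.hatTransport (D₂.baseChange v) Db eO := by
    rw [hpol, DualPair.lamTransport_left]; rfl
  have hcomm : polA.lam.left ≫ DualPair.hatTransport (D₂.baseChange v) Db eO = eO.hom.left ≫ pol.lam.left := by
    rw [hpoll, ← Category.assoc eO.hom.left, ← Over.comp_left, eO.hom_inv_id, Over.id_left, Category.id_comp]
  have hT : pol.HasType δ :=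
    Polarization.hasType_of_isBaseChangeVia (hAB := hAB) (D := Db) (DB := D₂.baseChange v) (hABh := hABh)
      polA pol hcomm hTA
  obtain ⟨ψ, hψ⟩ := LevelStructure.exists_comp_of_iso eO φA
  have hψσ : ∀ i, ψ.σ i = A₂.sectionBaseChange v (σ₂ i) := by
    intro i
    rw [hψ, hφA]
    apply Over.OverMorphism.ext
    rw [Over.comp_left]
    apply sqB.hom_ext
    · rw [Category.assoc, heOl, hEfst, hσb, ← Category.assoc, sectionBaseChange_left_comp_fst]
      exact ((Category.assoc _ _ _).trans ((whisker_eq v (hσ₂ i)).trans (Category.assoc _ _ _).symm)).symm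
    · rw [Category.assoc, heOl, hEsnd]
      exact (Over.w (σb i)).trans (Over.w (A₂.sectionBaseChange v (σ₂ i))).symm
  have hφψ : ∀ i, (φA.σ i).left ≫ eO.hom.left = 𝟙 T ≫ (ψ.σ i).left := fun i => by
    rw [hψ, Over.comp_left, Category.id_comp]
  have hLift : ψ.IsSymplecticLiftable pol δ :=
    LevelStructure.isSymplecticLiftable_of_isBaseChangeVia (hAB := hAB) (D := Db) (DB := D₂.baseChange v) (hABh := hABh)
      φA ψ hφψ polA pol hcomm ⟨eP⟩ δ hLA
  have hM : HasRank ((Scheme.Modules.pullback pr₂).obj L₀) 1 := hasRank_pullback pr₂ hL₀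
  have hMB : HasRank ((Scheme.Modules.pullback (X := (A₂.baseChange v).left) (pullback.fst A₂.X.hom v)).obj
      ((Scheme.Modules.pullback pr₂).obj L₀)) 1 := hasRank_pullback _ hM
  have hLB : HasRank (tensorObj ((Scheme.Modules.pullback (X := (A₂.baseChange v).left) (pullback.fst A₂.X.hom v)).obj
      ((Scheme.Modules.pullback pr₂).obj L₀)) ((Scheme.Modules.pullback (A₂.baseChange v).X.hom).obj (Modules.dual
        ((Scheme.Modules.pullback (A₂.baseChange v).unitSection).obj
          ((Scheme.Modules.pullback (X := (A₂.baseChange v).left) (pullback.fst A₂.X.hom v)).obj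
            ((Scheme.Modules.pullback pr₂).obj L₀)))))) 1 := (A₂.baseChange v).hasRank_normalised _ hMB
  have hLb : HasRank Lb 1 := hasRank_of_iso eLb.symm (hasRank_pullback prb hL₀)
  have hLb' : HasRank (tensorObj Lb ((Scheme.Modules.pullback Ab.X.hom).obj
      (Modules.dual ((Scheme.Modules.pullback Ab.unitSection).obj Lb)))) 1 := Ab.hasRank_normalised _ hLb
  have hT3 : Nonempty ((Scheme.Modules.pullback eO.symm.hom.left).obj (tensorObj Lb ((Scheme.Modules.pullback Ab.X.hom).obj
        (Modules.dual ((Scheme.Modules.pullback Ab.unitSection).obj Lb)))) ≅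
      tensorObj ((Scheme.Modules.pullback eO.symm.hom.left).obj Lb) ((Scheme.Modules.pullback (A₂.baseChange v).X.hom).obj
        (Modules.dual ((Scheme.Modules.pullback (A₂.baseChange v).unitSection).obj
          ((Scheme.Modules.pullback eO.symm.hom.left).obj Lb))))) :=
    nonempty_pullback_normalised_iso_of_comp_eq eO.symm.hom.left (Over.w eO.symm.hom)
      (unitSection_comp_hom_left eO.symm) hLb
  have iLbM : (Scheme.Modules.pullback eO.symm.hom.left).obj Lb ≅
      (Scheme.Modules.pullback (X := (A₂.baseChange v).left) (pullback.fst A₂.X.hom v)).obj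
        ((Scheme.Modules.pullback pr₂).obj L₀) :=
    (Scheme.Modules.pullback eO.symm.hom.left).mapIso eLb ≪≫ (Scheme.Modules.pullbackComp _ prb).app L₀ ≪≫
      (Scheme.Modules.pullbackCongr hEinv).app L₀ ≪≫ ((Scheme.Modules.pullbackComp (pullback.fst A₂.X.hom v) pr₂).app L₀).symm
  obtain ⟨t3⟩ := hT3
  obtain ⟨nc⟩ := nonempty_normalised_iso_of_iso (A₂.baseChange v) iLbM (hasRank_pullback _ hLb)
  have iLB := t3 ≪≫ nc
  have hεB := (A₂.baseChange v).cechPic_pullback_unitSection_detClass_normalised _ hMB (HasRank.isFiniteLocallyFree' hLB)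
  have hμ : ((𝟙 (A₂.baseChange v).X) ^ 6) ≫ pol.lam =
      DualPair.lamTransport Db (D₂.baseChange v) eO.symm eO (((𝟙 Ab.X) ^ 6) ≫ polA.lam) := by
    rw [hpol]
    simp only [DualPair.lamTransport, ← Category.assoc]
    rw [pow_id_comp_eq_comp_pow_id]
  have hT2 : ∀ ⦃U : Over T⦄ (a : U ⟶ (A₂.baseChange v).X),
      Nonempty ((Scheme.Modules.pullback ((A₂.baseChange v).X ◁
          (a ≫ DualPair.lamTransport Db (D₂.baseChange v) eO.symm eO (((𝟙 Ab.X) ^ 6) ≫ polA.lam))).left).obj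
          (D₂.baseChange v).P ≅
        (Scheme.Modules.pullback ((A₂.baseChange v).X ◁ a).left).obj ((A₂.baseChange v).mumfordBundle
          ((Scheme.Modules.pullback eO.symm.hom.left).obj (tensorObj Lb ((Scheme.Modules.pullback Ab.X.hom).obj
            (Modules.dual ((Scheme.Modules.pullback Ab.unitSection).obj Lb))))))) :=
    forall_nonempty_classify_lamTransport Db (D₂.baseChange v) eO.symm eO rfl _ hLb' hletA
  have hb := ((A₂.baseChange v).forall_nonempty_classify_iff_of_nonempty_iso (hasRank_pullback _ hLb') hLB
    (D₂.baseChange v) (DualPair.lamTransport Db (D₂.baseChange v) eO.symm eO (((𝟙 Ab.X) ^ 6) ≫ polA.lam)) ⟨iLB⟩).1 hT2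
  rw [← hμ] at hb
  have h6 : ((𝟙 (A₂.baseChange v).X) ^ 6) ≫ pol.lam = (Over.pullback v).map lam :=
    (A₂.baseChange v).eq_of_classify_mumfordBundle (D₂.baseChange v) hLB hεB _ _ hb
      (A₂.forall_nonempty_classify_pullback_map v D₂ hM lam hlam)
  let ΓT : (A₂.baseChange v).left ⟶ (A₂.baseChange v).prodLeft (D₂.hatBaseChange v) :=
    pullback.lift (𝟙 _) pol.lam.left (by rw [Category.id_comp]; exact (Over.w pol.lam).symm)
  have hΓT₁ : ΓT ≫ pullback.fst _ _ = 𝟙 _ := pullback.lift_fst _ _ _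
  have hΓT₂ : ΓT ≫ pullback.snd _ _ = pol.lam.left := pullback.lift_snd _ _ _
  have hΓ₁₁ : (ΓT ≫ D₂.prodBaseChangeToProd v) ≫ pullback.fst A₂.X.hom D₂.hat.X.hom = pullback.fst A₂.X.hom v := by
    rw [Category.assoc, DualPair.prodBaseChangeToProd_fst, reassoc_of% hΓT₁]
  have hΓ₁₂ : (ΓT ≫ D₂.prodBaseChangeToProd v) ≫ pullback.snd A₂.X.hom D₂.hat.X.hom =
      pol.lam.left ≫ pullback.fst D₂.hat.X.hom v := by
    rw [Category.assoc, DualPair.prodBaseChangeToProd_snd, reassoc_of% hΓT₂]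
  have hgr : Γ₁A ≫ pullback.map Ab.X.hom Db.hat.X.hom (A₂.baseChange v).X.hom (D₂.baseChange v).hat.X.hom eO.hom.left
        (DualPair.hatTransport (D₂.baseChange v) Db eO) (𝟙 T) (by rw [Category.comp_id, Over.w eO.hom])
        (by rw [Category.comp_id, DualPair.hatTransport_comp_hom]) = eO.hom.left ≫ ΓT := by
    apply pullback.hom_ext
    · rw [Category.assoc, pullback.lift_fst, reassoc_of% hΓA₁, Category.assoc]
      erw [hΓT₁]
      exact (Category.comp_id _).symm
    · rw [Category.assoc, pullback.lift_snd, reassoc_of% hΓA₂, Category.assoc]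
      erw [hΓT₂]
      exact hcomm
  have iP : (Scheme.Modules.pullback Γ₁A).obj Db.P ≅
      (Scheme.Modules.pullback eO.hom.left).obj ((Scheme.Modules.pullback (ΓT ≫ D₂.prodBaseChangeToProd v)).obj D₂.P) :=
    (Scheme.Modules.pullback Γ₁A).mapIso eP.symm ≪≫ (Scheme.Modules.pullbackComp Γ₁A _).app _ ≪≫
      (Scheme.Modules.pullbackCongr hgr).app _ ≪≫ ((Scheme.Modules.pullbackComp eO.hom.left ΓT).app _).symm ≪≫
      (Scheme.Modules.pullback eO.hom.left).mapIso ((Scheme.Modules.pullbackComp ΓT (D₂.prodBaseChangeToProd v)).app D₂.P)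
  have iP' : (Scheme.Modules.pullback eO.symm.hom.left).obj ((Scheme.Modules.pullback Γ₁A).obj Db.P) ≅
      (Scheme.Modules.pullback (ΓT ≫ D₂.prodBaseChangeToProd v)).obj D₂.P :=
    (Scheme.Modules.pullback eO.symm.hom.left).mapIso iP ≪≫ (Scheme.Modules.pullbackComp _ _).app _ ≪≫
      (Scheme.Modules.pullbackCongr (show eO.symm.hom.left ≫ eO.hom.left = 𝟙 _ by
        rw [← Over.comp_left, Iso.symm_hom, eO.inv_hom_id, Over.id_left])).app _ ≪≫
      (Scheme.Modules.pullbackId _).app _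
  obtain ⟨enB⟩ := A₂.nonempty_pullback_normalised_iso_normalised_pullback v hM
  obtain ⟨tp⟩ := nonempty_pullback_tensorPow_iso eO.symm.hom.left (hasRank_pullback Γ₁A Db.hasRank_one) 3
  obtain ⟨t1⟩ := nonempty_tensorPow_iso_of_iso' iP' 3
  have hmod : Nonempty ((Scheme.Modules.pullback (pullback.fst A₂.X.hom v)).obj
      (tensorObj ((Scheme.Modules.pullback pr₂).obj L₀) ((Scheme.Modules.pullback A₂.X.hom).obj
        (Modules.dual ((Scheme.Modules.pullback A₂.unitSection).obj ((Scheme.Modules.pullback pr₂).obj L₀))))) ≅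
      tensorPow ((Scheme.Modules.pullback (ΓT ≫ D₂.prodBaseChangeToProd v)).obj D₂.P) 3) :=
    ⟨enB ≪≫ iLB.symm ≪≫ (Scheme.Modules.pullback eO.symm.hom.left).mapIso eA3 ≪≫ tp ≪≫ t1⟩
  have hVI' := isIso_pullback_map_comp_pushforwardBaseChangeHom_of_isPullback_of_isPullback sqb sqB L₀ u₀ hVIA
  have hVI : IsIso ((Scheme.Modules.pullback v).map
      (eF.inv ≫ (Scheme.Modules.pullback (j₂ ≫ j₁)).map u₀ ≫ pushforwardBaseChangeHom sq₂.w L₀) ≫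
        pushforwardBaseChangeHom (IsPullback.of_hasPullback A₂.X.hom v).w ((Scheme.Modules.pullback pr₂).obj L₀)) := by
    rw [Functor.map_comp, Category.assoc ((Scheme.Modules.pullback v).map eF.inv), isIso_comp_left_iff,
      isIso_pullback_map_comp_pushforwardBaseChangeHom_iff_of_isPullback_paste_horiz sq₂
        (IsPullback.of_hasPullback A₂.X.hom v) L₀ u₀]
    exact (isIso_comp_pushforwardBaseChangeHom_congr (Category.assoc v j₂ j₁) rfl L₀ u₀).1 hVI'
  exact ⟨pol.lam, ΓT ≫ D₂.prodBaseChangeToProd v, pol.isMonHom, h6, hΓ₁₁, hΓ₁₂, hmod, pol, rfl, hT, ⟨ψ, hψσ, hLift⟩, hVI⟩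


include sq₂ hg₂ hunit₂ hσ₂ hD₂ hL₀ hlam in
/-- **HEAD — THE `T`-POINTS OF THE MFK SUB-FUNCTOR OF HILB, INTRINSICALLY** ([MumfordFogartyKirwan1994] Prop. 7.3, steps
(I)–(VI), read on the raw square): in the setting exported by ★ FILE 2 `exists_isImmersion_iff_mfkSubfunctor`, a morphism
`b : T ⟶ H₀` from a locally Noetherian `T` factors (uniquely) through the composite immersion `H ↪ H₂ ↪ H₁ ↪ H₀` if and only
if `INT(b)`: the fibres of `Z₀ ×_{H₀} T → T` are smooth and geometrically connected and SOME abelian scheme `A_b/T` on a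
cartesian square over `p₀` along `b`, with unit `ε₀|_T`, sections `τ₀|_T`, a rigidified dual pair and a rank-one
`L_b ≅ L₀|_{A_b}`, satisfies the five clauses (V)/(P)/(III)(IV)(V′)/(VI) over `T` (★ `mfkIntrinsic_of_existsUnique_comp`, ★
`existsUnique_comp_of_mfkIntrinsic`).  This is the shape consumed by the representability of `𝒜_{g,δ,N}` ((H-rep)).
[cite: MumfordFogartyKirwan1994, Ch. 7 §2 Proposition 7.3 (pp. 132–134)] [cite: MumfordFogartyKirwan1994, Ch. 7 §2 Definition 7.2 (p. 129)] -/
theorem existsUnique_comp_iff_mfkIntrinsic [Mono j₁] [Mono j₂] [Mono j]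
    (h₁ : ∀ {T XT : Scheme.{0}} (b : T ⟶ H₀) {pr : XT ⟶ Z₀} {pT : XT ⟶ T} (_ : IsPullback pr pT p₀ b),
      (∃! v₁ : T ⟶ H₁, v₁ ≫ j₁ = b) ↔ Smooth pT ∧ GeometricallyConnected pT)
    (h₂ : ∀ ⦃T : Scheme.{0}⦄ (v₁ : T ⟶ H₁),
      (∃! v : T ⟶ H₂, v ≫ j₂ = v₁) ↔
        ∃ G' : GrpObj (Over.mk (pullback.snd (pullback.snd p₀ j₁) v₁)),
          (@MonObj.one _ _ _ (Over.mk (pullback.snd (pullback.snd p₀ j₁) v₁)) G'.toMonObj).left ≫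
              pullback.fst (pullback.snd p₀ j₁) v₁ ≫ pullback.fst p₀ j₁ = (v₁ ≫ j₁) ≫ ε₀ ∧
          SmoothOfRelativeDimension g (pullback.snd (pullback.snd p₀ j₁) v₁))
    (h : ∀ ⦃T : Scheme.{0}⦄ [IsLocallyNoetherian T] (v : T ⟶ H₂),
      (∃! w : T ⟶ H, w ≫ j = v) ↔
        ∃ (ω : (A₂.baseChange v).X ⟶ (D₂.hat.baseChange v).X)
          (Γ₁ : (A₂.baseChange v).left ⟶ A₂.prodLeft D₂.hat),
          IsMonHom ω ∧ ((𝟙 (A₂.baseChange v).X) ^ 6) ≫ ω = (Over.pullback v).map lam ∧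
            Γ₁ ≫ pullback.fst A₂.X.hom D₂.hat.X.hom = pullback.fst A₂.X.hom v ∧
            Γ₁ ≫ pullback.snd A₂.X.hom D₂.hat.X.hom = ω.left ≫ pullback.fst D₂.hat.X.hom v ∧
            Nonempty ((Scheme.Modules.pullback (pullback.fst A₂.X.hom v)).obj
                (tensorObj ((Scheme.Modules.pullback pr₂).obj L₀) ((Scheme.Modules.pullback A₂.X.hom).obj
                  (Modules.dual ((Scheme.Modules.pullback A₂.unitSection).obj
                    ((Scheme.Modules.pullback pr₂).obj L₀))))) ≅
              tensorPow ((Scheme.Modules.pullback Γ₁).obj D₂.P) 3) ∧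
            ∃ pol : (A₂.baseChange v).Polarization (D₂.baseChange v), pol.lam = ω ∧ pol.HasType δ ∧
              (∃ φ : LevelStructure g N (A₂.baseChange v),
                (∀ i, φ.σ i = A₂.sectionBaseChange v (σ₂ i)) ∧ φ.IsSymplecticLiftable pol δ) ∧
              IsIso ((Scheme.Modules.pullback v).map
                  (eF.inv ≫ (Scheme.Modules.pullback (j₂ ≫ j₁)).map u₀ ≫ pushforwardBaseChangeHom sq₂.w L₀) ≫
                pushforwardBaseChangeHom (IsPullback.of_hasPullback A₂.X.hom v).w
                  ((Scheme.Modules.pullback pr₂).obj L₀)))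
    {T : Scheme.{0}} [IsLocallyNoetherian T] (b : T ⟶ H₀) :
    (∃! w : T ⟶ H, w ≫ j ≫ j₂ ≫ j₁ = b) ↔
      (Smooth (pullback.snd p₀ b) ∧ GeometricallyConnected (pullback.snd p₀ b) ∧
      ∃ (Ab : AbelianSchemeOver T) (prb : Ab.X.left ⟶ Z₀) (sqb : IsPullback prb Ab.X.hom p₀ b)
        (_ : Ab.IsOfRelDim g) (_ : Ab.unitSection ≫ prb = b ≫ ε₀)
        (σb : Fin g ⊕ Fin g → Ab.Sections) (_ : ∀ i, (σb i).left ≫ prb = b ≫ τ₀ i)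
        (Db : Ab.DualPair)
        (_ : Nonempty ((Scheme.Modules.pullback (DualPair.unitHatSlice Db)).obj Db.P ≅ SheafOfModules.unit _))
        (Lb : Ab.left.Modules) (_ : Nonempty (Lb ≅ (Scheme.Modules.pullback prb).obj L₀))
        (ω : Ab.X ⟶ Db.hat.X) (Γ₁ : Ab.left ⟶ Ab.prodLeft Db.hat),
        IsMonHom ω ∧
          (∀ ⦃U : Over T⦄ (a : U ⟶ Ab.X),
            Nonempty ((Scheme.Modules.pullback (Ab.X ◁ (a ≫ ((𝟙 Ab.X) ^ 6) ≫ ω)).left).obj Db.P ≅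
              (Scheme.Modules.pullback (Ab.X ◁ a).left).obj (Ab.mumfordBundle
                (tensorObj Lb ((Scheme.Modules.pullback Ab.X.hom).obj
                  (Modules.dual ((Scheme.Modules.pullback Ab.unitSection).obj Lb))))))) ∧
          Γ₁ ≫ pullback.fst Ab.X.hom Db.hat.X.hom = 𝟙 _ ∧
          Γ₁ ≫ pullback.snd Ab.X.hom Db.hat.X.hom = ω.left ∧
          Nonempty (tensorObj Lb ((Scheme.Modules.pullback Ab.X.hom).obj
              (Modules.dual ((Scheme.Modules.pullback Ab.unitSection).obj Lb))) ≅
            tensorPow ((Scheme.Modules.pullback Γ₁).obj Db.P) 3) ∧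
          ∃ pol : Ab.Polarization Db, pol.lam = ω ∧ pol.HasType δ ∧
            (∃ φ : LevelStructure g N Ab, (∀ i, φ.σ i = σb i) ∧ φ.IsSymplecticLiftable pol δ) ∧
            IsIso ((Scheme.Modules.pullback b).map u₀ ≫ pushforwardBaseChangeHom sqb.w L₀)) :=
  ⟨fun hw => mfkIntrinsic_of_existsUnique_comp p₀ ε₀ τ₀ L₀ δ u₀ j₁ j₂ j A₂ pr₂ sq₂ hg₂ hunit₂ σ₂ hσ₂ D₂ hD₂ hL₀ eF lam
      hlam h₁ h b hw,
    fun hI => existsUnique_comp_of_mfkIntrinsic p₀ ε₀ τ₀ L₀ δ u₀ j₁ j₂ j A₂ pr₂ sq₂ hunit₂ σ₂ hσ₂ D₂ hD₂ hL₀ eF lam hlam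
      h₁ h₂ h b hI⟩

end Converse

end AbelianSchemeOver

end Literature.AlgebraicGeometry.AbelianSchemes
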